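/-
Copyright (c) 2026. All rights reserved.
Released under Apache 2.0 license as described in the file LICENSE.
Authors: abc-iut cell, seat abc-iut-f-069 (gen 7; row «CT2b / G-L4t6g8-2 residual», file 3 of 5).
-/
import Literature.AnabelianGeometry.AbsoluteAnabelian.AbsTopII.DehnTwistLevelFoxChains
import Literature.AnabelianGeometry.AbsoluteAnabelian.AbsTopII.DehnTwistLoopLogPoints
import Literature.AnabelianGeometry.AbsoluteAnabelian.ZHatCompletionFreeProcyclic
import HarnessLib

/-!
# Affine pro-cyclic dynamics `h ↦ z^ν h τ^{-ν}` on `Π_I = F̂₂ ⋊_{shear^i} Ẑ`: stabilisers, `ℓ`-freeness, period growth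

S. Mochizuki, *Topics in Absolute Anabelian Geometry II* [AbsTopII] (`MochizukiAbsTopII2013`) §1 Prop 1.3 (viii) p. 12,
at the nodal Dehn-twist datum of abc-iut-L4-t6 (`DehnTwistExtension`: `Π_I = Ext i = F̂₂ ⋊_{shear^i} Ẑ`);
Ribes–Zalesskii, *Profinite Groups*, Thm 2.7.1 (`Ẑ ≅ ∏_p ℤ_p`) [cite: RibesZalesskii2010, Thm 2.7.1].
PROOF-ONLY file (no definition, no instance, no notation), abc-iut-f-069 (gen 7); file 3 of the chain closing the
residual «CT2» of GAP row G-L4t6g8-2 (hypothesis of L4-t6's `prop_1_3_viii′_dpsc_of_CT2`, p487638).  For continuous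
one-parameter groups `Z, T : Ẑ → Π_I` the maps `σ_ν(h) = Z(ν) h T(ν)⁻¹` form a `Ẑ`-action on `Π_I`; in a finite quotient
`Π_I/V` the generator acts by the AFFINE PERMUTATION `σ̄(h) = z̄ h τ̄⁻¹` (`affine_pow_apply`).
* `pow_mem_of_isClosed_of_iotaZ_mem` — a closed subgroup of `Ẑ` containing `ι(n)` contains all `n`-th powers;
  `exists_ell_adic_unit_vector` — `ε ≠ 1` in `Ẑ` divisible by every `r` prime to `ℓ` (unit vector of `ℤ_ℓ ≤ ∏_p ℤ_p`);
* `mk_act_pow_eq` — the level stabiliser `{ν : σ_ν(g) ≡ g mod V}` is a closed subgroup containing `ι(period)`;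
* `exists_openNormal_pow_dvd_minimalPeriod` — **PERIOD GROWTH FROM `ℓ`-FREENESS**: if no `ν ≠ 1` divisible by all `r`
  prime to `ℓ` fixes `g`, every `ℓ^c` divides the `σ̄`-period of `ḡ` in some finite quotient (else `ε^{ℓ^c}` fixes `g`);
* `minimalPeriod_map_dvd` — periods divide along the tower; `exists_openNormal_forall_fibre_dvd` — **uniformisation
  over a fibre** by compactness of `g₀V`: one finer level at which every point over `ḡ` has period divisible by `d`;
* `mk_inr_conj` (the twist is inner in `Π_I/V`) and the compactness step `⋂_V K·V = K`
  (`mem_of_forall_exists_inv_mul_mem`, `eq_of_forall_mk_eq`).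
HONEST FRAMING: classical profinite group theory under OUR kernel check, at a constructed model (constructed ≠
geometric); nothing here bears on [IUTchIII] Cor 3.12; no side taken.
-/

noncomputable section

open scoped Pointwise

namespace Literature.AnabelianGeometry.AbsoluteAnabelian.AbsTopII.DehnTwist

open Literature.AnabelianGeometry.EtaleTheta.SettingModel
open Literature.AnabelianGeometry.EtaleTheta
open Literature.AnabelianGeometry.AbsoluteAnabelian
open Literature.GroupTheory.CombinatorialGroupTheory.FoxChain
open Function _root_.Topology

variable {i : ℕ}

/-! ### The levels `G = Π_I / V` and the compactness step -/

section ExtLevel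

/-- In `Π_I / V`, conjugating the image of `x ∈ F̂₂` by the image of the twist `(1, k')` gives the image of
`shear^i(k') x`. [cite: MochizukiAbsTopII2013, Def 1.2 (ii) p.10] -/
theorem mk_inr_conj (V : OpenNormalSubgroup (Ext i)) (k' : ZH) (x : F₂hatT) :
    (QuotientGroup.mk' V.toSubgroup (SemidirectProduct.inr k') : Ext i ⧸ V.toSubgroup) *
        QuotientGroup.mk' V.toSubgroup (SemidirectProduct.inl x) *
        (QuotientGroup.mk' V.toSubgroup (SemidirectProduct.inr k'))⁻¹ =
      QuotientGroup.mk' V.toSubgroup (SemidirectProduct.inl (shearPow i k' x)) := by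
  rw [← map_mul, ← map_inv, ← map_mul, ← map_inv, ← SemidirectProduct.inl_aut]

/-- **Compactness step `⋂_V K·V = K`**: if a closed set `K ⊆ Π_I` meets `g·V` for EVERY open normal subgroup `V`, then
`g ∈ K`. [cite: RibesZalesskii2010, Lemma 3.2.1] -/
theorem mem_of_forall_exists_inv_mul_mem {K : Set (Ext i)} (hK : IsClosed K) {g : Ext i}
    (h : ∀ V : OpenNormalSubgroup (Ext i), ∃ y ∈ K, y⁻¹ * g ∈ (V : Set (Ext i))) : g ∈ K := by
  by_contra hg
  set S : Set (Ext i) := (fun y : Ext i => y⁻¹ * g) '' K with hS_def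
  have hS : IsCompact S := hK.isCompact.image (continuous_inv.mul continuous_const)
  have h1S : (1 : Ext i) ∈ Sᶜ := by
    rintro ⟨y, hy, hyg⟩
    apply hg
    have : g = y := by
      have := inv_mul_eq_one.mp hyg
      exact this.symm
    rw [this]; exact hy
  obtain ⟨V, hV⟩ := ProfiniteGrp.exist_openNormalSubgroup_sub_open_nhds_of_one hS.isClosed.isOpen_compl h1S
  obtain ⟨y, hy, hyV⟩ := h V
  exact hV hyV ⟨y, hy, rfl⟩

end ExtLevel

/-! ### Affine permutations `h ↦ z̄ h τ̄⁻¹` of a group -/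

section Affine

variable {G : Type*} [Group G]

/-- `σ̄(h) = z̄ · h · τ̄⁻¹`. [cite: MochizukiAbsTopII2013, Prop 1.3 (viii) p.12] -/
theorem affine_apply (z τ h : G) : ((Equiv.mulRight τ⁻¹).trans (Equiv.mulLeft z)) h = z * (h * τ⁻¹) := rfl

/-- `σ̄^n(h) = z̄^n · h · (τ̄^n)⁻¹`. [cite: MochizukiAbsTopII2013, Prop 1.3 (viii) p.12] -/
theorem affine_pow_apply (z τ : G) (n : ℕ) (h : G) :
    (((Equiv.mulRight τ⁻¹).trans (Equiv.mulLeft z)) ^ n) h = z ^ n * h * (τ ^ n)⁻¹ := by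
  induction n generalizing h with
  | zero => simp
  | succ n ih =>
    rw [pow_succ, Equiv.Perm.mul_apply, affine_apply, ih, pow_succ, pow_succ, mul_inv_rev]
    group

end Affine

/-! ### Closed subgroups of `Ẑ`, the `ℓ`-adic unit vector -/

section ZHat

/-- `Ẑ` is commutative: any two elements commute. [cite: RibesZalesskii2010, Thm 2.7.1] -/
theorem commute_zh (a b : ZH) : Commute a b := ZHatCompletion.mul_comm a b

/-- A CLOSED subgroup of `Ẑ` containing `ι(n)` contains every `n`-th power (`μ ↦ μ^n` is continuous, `ι(ℤ)` is dense,
`ι(1)^n = ι(n)`). [cite: RibesZalesskii2010, Thm 2.7.1] -/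
theorem pow_mem_of_isClosed_of_iotaZ_mem (H : Subgroup ZH) (hH : IsClosed (H : Set ZH)) (n : ℕ)
    (hn : iotaZ (Multiplicative.ofAdd (n : ℤ)) ∈ H) (μ : ZH) : μ ^ n ∈ H := by
  let D : Subgroup ZH :=
    { carrier := {μ | μ ^ n ∈ H}
      one_mem' := by show (1 : ZH) ^ n ∈ H; rw [one_pow]; exact H.one_mem
      mul_mem' := fun {a b} ha hb => by
        show (a * b) ^ n ∈ H
        rw [(commute_zh a b).mul_pow]
        exact H.mul_mem ha hb
      inv_mem' := fun {a} ha => by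
        show a⁻¹ ^ n ∈ H
        rw [inv_pow]; exact H.inv_mem ha }
  have hD : IsClosed (D : Set ZH) := by
    change IsClosed ((fun μ : ZH => μ ^ n) ⁻¹' (H : Set ZH))
    exact hH.preimage (continuous_pow n)
  have h1 : iotaZ (Multiplicative.ofAdd 1) ∈ D := by
    show iotaZ (Multiplicative.ofAdd 1) ^ n ∈ H
    rw [iotaZ_one_pow]; exact hn
  have hall : (Set.univ : Set ZH) ⊆ D := by
    rw [← ZHatCompletion.dense_zpowers_eta_one.closure_eq]
    exact closure_minimal (fun s hs => (Subgroup.zpowers_le.mpr h1) hs) hD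
  exact hall (Set.mem_univ μ)

/-- **The `ℓ`-adic unit vector of `Ẑ ≅ ∏_p ℤ_p`**: for a prime `ℓ` there is `ε ∈ Ẑ`, `ε ≠ 1`, which is an `r`-th power
for every `r ≥ 1` prime to `ℓ` (component `1` at `ℓ`, `0` elsewhere; `r` is a unit of `ℤ_ℓ`).
[cite: RibesZalesskii2010, Thm 2.7.1] -/
theorem exists_ell_adic_unit_vector (ℓ : ℕ) (hℓ : ℓ.Prime) :
    ∃ ε : ZH, ε ≠ 1 ∧ ∀ r : ℕ, 0 < r → ℓ.Coprime r → ∃ μ : ZH, μ ^ r = ε := by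
  obtain ⟨e, -⟩ := ZHatCompletion.exists_continuousMulEquiv_padicProd
  let L : Nat.Primes := ⟨ℓ, hℓ⟩
  haveI : Fact (Nat.Prime (L : ℕ)) := ⟨L.2⟩
  let v : ∀ p : Nat.Primes, @PadicInt (p : ℕ) ⟨p.2⟩ := Pi.single L 1
  refine ⟨e.symm (Multiplicative.ofAdd v), ?_, ?_⟩
  · intro h
    have h1 : Multiplicative.ofAdd v = 1 := by
      have := congrArg e h
      rwa [ContinuousMulEquiv.apply_symm_apply, map_one] at this
    have h2 : v L = 0 := by
      have := congrArg (fun w => (Multiplicative.toAdd w) L) h1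
      simpa using this
    simp [v] at h2
  · intro r hr hcop
    -- `r` is a unit of `ℤ_ℓ`
    have hunit : IsUnit ((r : ℤ) : @PadicInt (L : ℕ) ⟨L.2⟩) := by
      rw [PadicInt.isUnit_iff]
      refine le_antisymm (PadicInt.norm_le_one _) (not_lt.mp fun hlt => ?_)
      rw [PadicInt.norm_int_lt_one_iff_dvd] at hlt
      have : (ℓ : ℤ) ∣ (r : ℤ) := hlt
      exact (Nat.Prime.coprime_iff_not_dvd hℓ).mp hcop (by exact_mod_cast this)
    obtain ⟨w, hw⟩ := hunit
    let v' : ∀ p : Nat.Primes, @PadicInt (p : ℕ) ⟨p.2⟩ := Pi.single L (↑w⁻¹)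
    refine ⟨e.symm (Multiplicative.ofAdd v'), ?_⟩
    rw [← map_pow]
    congr 1
    rw [← ofAdd_nsmul]
    congr 1
    funext p
    simp only [v, v', Pi.smul_apply]
    by_cases hp : p = L
    · subst hp
      rw [Pi.single_eq_same, Pi.single_eq_same, nsmul_eq_mul]
      have : ((r : ℕ) : @PadicInt (L : ℕ) ⟨L.2⟩) = ((r : ℤ) : @PadicInt (L : ℕ) ⟨L.2⟩) := by push_cast; rfl
      rw [this, ← hw, Units.mul_inv]
    · rw [Pi.single_eq_of_ne hp, Pi.single_eq_of_ne hp, smul_zero]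

/-- A power of an element divisible by every `r` prime to `ℓ` is again so divisible. [cite: RibesZalesskii2010, Thm 2.7.1] -/
theorem forall_exists_pow_eq_pow {ℓ : ℕ} {ε : ZH} (hε : ∀ r : ℕ, 0 < r → ℓ.Coprime r → ∃ μ : ZH, μ ^ r = ε)
    (m : ℕ) : ∀ r : ℕ, 0 < r → ℓ.Coprime r → ∃ μ : ZH, μ ^ r = ε ^ m := by
  intro r hr hcop
  obtain ⟨μ, rfl⟩ := hε r hr hcop
  exact ⟨μ ^ m, by rw [← pow_mul, mul_comm, pow_mul]⟩

end ZHat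

/-! ### The `Ẑ`-action `σ_ν(h) = Z(ν) · h · T(ν)⁻¹` on `Π_I` and its level stabilisers -/

section Action

/-- If `σ_ν(g) ≡ g` modulo EVERY open normal subgroup of `Π_I`, then `σ_ν(g) = g` (`Π_I` is profinite).
[cite: RibesZalesskii2010, Lemma 3.2.1] -/
theorem eq_of_forall_mk_eq {g g' : Ext i}
    (h : ∀ V : OpenNormalSubgroup (Ext i), (QuotientGroup.mk' V.toSubgroup g' : Ext i ⧸ V.toSubgroup) =
      QuotientGroup.mk' V.toSubgroup g) : g' = g := by
  have hmem : g' ∈ ({g} : Set (Ext i)) := by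
    refine mem_of_forall_exists_inv_mul_mem isClosed_singleton fun V => ⟨g, rfl, ?_⟩
    have := h V
    rw [QuotientGroup.mk'_apply, QuotientGroup.mk'_apply, eq_comm, QuotientGroup.eq] at this
    exact this
  exact hmem

/-- **The level stabiliser is a closed subgroup of `Ẑ` containing `ι(period)`**, hence every `period`-th power: if
`n` is a period of `ḡ` under `σ̄ = (h ↦ z̄ h τ̄⁻¹)` in `Π_I/V` (`z̄, τ̄` the images of `Z(ι1), T(ι1)`), then
`σ_{μ^n}(g) ≡ g (mod V)` for every `μ ∈ Ẑ`. [cite: RibesZalesskii2010, Thm 2.7.1] -/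
theorem mk_act_pow_eq (Z T : ZH →ₜ* Ext i) (V : OpenNormalSubgroup (Ext i)) (g : Ext i) (n : ℕ)
    (hn : (((Equiv.mulRight (QuotientGroup.mk' V.toSubgroup (T (iotaZ (Multiplicative.ofAdd 1))))⁻¹).trans
      (Equiv.mulLeft (QuotientGroup.mk' V.toSubgroup (Z (iotaZ (Multiplicative.ofAdd 1)))))) ^ n)
        (QuotientGroup.mk' V.toSubgroup g) = QuotientGroup.mk' V.toSubgroup g)
    (μ : ZH) :
    (QuotientGroup.mk' V.toSubgroup (Z (μ ^ n) * g * (T (μ ^ n))⁻¹) : Ext i ⧸ V.toSubgroup) =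
      QuotientGroup.mk' V.toSubgroup g := by
  set π := QuotientGroup.mk' V.toSubgroup with hπ
  -- the level stabiliser as a subgroup of `Ẑ`
  let S : Subgroup ZH :=
    { carrier := {ν | π (Z ν * g * (T ν)⁻¹) = π g}
      one_mem' := by show π (Z 1 * g * (T 1)⁻¹) = π g; rw [map_one, map_one, inv_one, one_mul, mul_one]
      mul_mem' := fun {a b} ha hb => by
        change π (Z a * g * (T a)⁻¹) = π g at ha
        change π (Z b * g * (T b)⁻¹) = π g at hb
        show π (Z (a * b) * g * (T (a * b))⁻¹) = π g
        have : Z (a * b) * g * (T (a * b))⁻¹ = Z a * (Z b * g * (T b)⁻¹) * (T a)⁻¹ := by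
          rw [map_mul, map_mul, mul_inv_rev]; group
        rw [this, map_mul, map_mul, hb, ← map_mul, ← map_mul, ha]
      inv_mem' := fun {a} ha => by
        change π (Z a * g * (T a)⁻¹) = π g at ha
        show π (Z a⁻¹ * g * (T a⁻¹)⁻¹) = π g
        have ha' : π (Z a) * π g * (π (T a))⁻¹ = π g := by simpa only [map_mul, map_inv] using ha
        have hga : Z a⁻¹ * (Z a * g * (T a)⁻¹) * (T a⁻¹)⁻¹ = g := by
          rw [map_inv, map_inv, inv_inv]; group
        conv_rhs => rw [← hga]
        simp only [map_mul, map_inv, ha'] }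
  have hS : IsClosed (S : Set ZH) := by
    change IsClosed ((fun ν : ZH => π (Z ν * g * (T ν)⁻¹)) ⁻¹' {π g})
    refine (isClosed_discrete _).preimage ?_
    haveI : DiscreteTopology (Ext i ⧸ V.toSubgroup) := inferInstance
    exact QuotientGroup.continuous_mk.comp ((Z.continuous.mul continuous_const).mul T.continuous.inv)
  -- `ι(n) ∈ S` : this is the periodicity hypothesis
  have hιn : iotaZ (Multiplicative.ofAdd (n : ℤ)) ∈ S := by
    show π (Z (iotaZ (Multiplicative.ofAdd (n : ℤ))) * g * (T (iotaZ (Multiplicative.ofAdd (n : ℤ))))⁻¹) = π g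
    rw [← iotaZ_one_pow, map_pow, map_pow, map_mul, map_mul, map_inv, map_pow, map_pow, ← affine_pow_apply]
    exact hn
  exact pow_mem_of_isClosed_of_iotaZ_mem S hS n hιn μ

/-- **PERIOD GROWTH FROM `ℓ`-FREENESS.**  If no `ν ≠ 1` divisible by every `r` prime to `ℓ` satisfies
`Z(ν) g T(ν)⁻¹ = g`, then for every `c` there is a finite quotient `Π_I/V` in which the period of `ḡ` under
`σ̄ = (h ↦ z̄ h τ̄⁻¹)` is divisible by `ℓ^c`.  (Otherwise `ν = ε^{ℓ^c}`, `ε` the `ℓ`-adic unit vector, is a `period`-th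
power at EVERY level, hence fixes `g`; but `ν ≠ 1`.) [cite: RibesZalesskii2010, Thm 2.7.1] -/
theorem exists_openNormal_pow_dvd_minimalPeriod {ℓ : ℕ} (hℓ : ℓ.Prime) (Z T : ZH →ₜ* Ext i) (g : Ext i)
    (hfree : ∀ ν : ZH, (∀ r : ℕ, 0 < r → ℓ.Coprime r → ∃ μ : ZH, μ ^ r = ν) → Z ν * g * (T ν)⁻¹ = g → ν = 1)
    (c : ℕ) : ∃ V : OpenNormalSubgroup (Ext i), ℓ ^ c ∣ Function.minimalPeriod
      ((Equiv.mulRight (QuotientGroup.mk' V.toSubgroup (T (iotaZ (Multiplicative.ofAdd 1))))⁻¹).trans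
        (Equiv.mulLeft (QuotientGroup.mk' V.toSubgroup (Z (iotaZ (Multiplicative.ofAdd 1))))))
      (QuotientGroup.mk' V.toSubgroup g) := by
  by_contra hcon
  rw [not_exists] at hcon
  obtain ⟨ε, hε1, hεdiv⟩ := exists_ell_adic_unit_vector ℓ hℓ
  set ν : ZH := ε ^ (ℓ ^ c) with hν
  -- `ν` fixes `g` modulo every `V`
  have hfix : ∀ V : OpenNormalSubgroup (Ext i),
      (QuotientGroup.mk' V.toSubgroup (Z ν * g * (T ν)⁻¹) : Ext i ⧸ V.toSubgroup) = QuotientGroup.mk' V.toSubgroup g := by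
    intro V
    haveI : Finite (Ext i ⧸ V.toSubgroup) := Subgroup.quotient_finite_of_isOpen _ V.toOpenSubgroup.isOpen
    set σV := (Equiv.mulRight (QuotientGroup.mk' V.toSubgroup (T (iotaZ (Multiplicative.ofAdd 1))))⁻¹).trans
        (Equiv.mulLeft (QuotientGroup.mk' V.toSubgroup (Z (iotaZ (Multiplicative.ofAdd 1))))) with hσV
    set n := Function.minimalPeriod σV (QuotientGroup.mk' V.toSubgroup g) with hndef
    have hn0 : n ≠ 0 := by
      have hfun : (fun y : Ext i ⧸ V.toSubgroup => σV • y) = ⇑σV := funext fun y => Equiv.Perm.smul_def σV y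
      have := (MulAction.minimalPeriod_pos (a := σV) (b := QuotientGroup.mk' V.toSubgroup g)).ne
      rwa [hfun] at this
    -- `n = ℓ^a · r` with `ℓ ∤ r` and `a < c`
    obtain ⟨a, r, hr, hnar⟩ := Nat.exists_eq_pow_mul_and_not_dvd hn0 ℓ hℓ.ne_one
    have hr0 : 0 < r := Nat.pos_of_ne_zero (by rintro rfl; simp at hnar; exact hn0 hnar)
    have hac : a < c := by
      by_contra hca
      apply hcon V
      rw [← hndef, hnar]
      exact Dvd.dvd.mul_right (pow_dvd_pow ℓ (not_lt.mp hca)) r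
    -- `ν` is an `n`-th power
    obtain ⟨μ, hμ⟩ := hεdiv r hr0 ((Nat.Prime.coprime_iff_not_dvd hℓ).mpr hr)
    have hexp : ℓ ^ (c - a) * n = r * ℓ ^ c := by
      rw [hnar, mul_comm (ℓ ^ a) r, mul_left_comm, ← pow_add, Nat.sub_add_cancel hac.le]
    have hνn : ν = (μ ^ (ℓ ^ (c - a))) ^ n := by
      rw [← pow_mul, hexp, pow_mul, hμ]
    rw [hνn]
    refine mk_act_pow_eq Z T V g n ?_ _
    rw [Equiv.Perm.coe_pow]
    exact Function.isPeriodicPt_minimalPeriod σV _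
  have hνg : Z ν * g * (T ν)⁻¹ = g := eq_of_forall_mk_eq hfix
  have hν1 : ν = 1 := hfree ν (forall_exists_pow_eq_pow hεdiv (ℓ ^ c)) hνg
  exact hε1 (ZHatCompletion.eq_one_of_pow_eq_one (pow_ne_zero c hℓ.ne_zero) (hν ▸ hν1))

end Action

/-! ### Periods along the tower, and uniformisation over a fibre -/

section Tower

/-- `V' ≤ V` in the form consumed by `QuotientGroup.map _ _ (MonoidHom.id _)`. [cite: RibesZalesskii2010, Lemma 3.2.1] -/
theorem le_comap_id_of_le {V' V : OpenNormalSubgroup (Ext i)} (hle : V' ≤ V) :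
    V'.toSubgroup ≤ (V.toSubgroup).comap (MonoidHom.id (Ext i)) := fun x hx => by
  rw [Subgroup.mem_comap, MonoidHom.id_apply]
  exact hle hx

/-- The induced homomorphism `Π_I/V' → Π_I/V` on representatives. [cite: RibesZalesskii2010, Lemma 3.2.1] -/
theorem map_mk'_eq {V' V : OpenNormalSubgroup (Ext i)} (hle : V' ≤ V) (y : Ext i) :
    QuotientGroup.map V'.toSubgroup V.toSubgroup (MonoidHom.id _) (le_comap_id_of_le hle)
      (QuotientGroup.mk' V'.toSubgroup y) = QuotientGroup.mk' V.toSubgroup y := rfl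

/-- The induced map `Π_I/V' → Π_I/V` for `V' ≤ V` intertwines the affine permutations. [cite: MochizukiAbsTopII2013, Prop 1.3 (viii) p.12] -/
theorem semiconj_map_affine {V' V : OpenNormalSubgroup (Ext i)} (hle : V' ≤ V) (z τ : Ext i) :
    Function.Semiconj (QuotientGroup.map V'.toSubgroup V.toSubgroup (MonoidHom.id _) (le_comap_id_of_le hle))
      ((Equiv.mulRight (QuotientGroup.mk' V'.toSubgroup τ)⁻¹).trans (Equiv.mulLeft (QuotientGroup.mk' V'.toSubgroup z)))
      ((Equiv.mulRight (QuotientGroup.mk' V.toSubgroup τ)⁻¹).trans (Equiv.mulLeft (QuotientGroup.mk' V.toSubgroup z))) := by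
  intro x
  obtain ⟨x, rfl⟩ := QuotientGroup.mk'_surjective V'.toSubgroup x
  rw [affine_apply, affine_apply, map_mul, map_mul, map_inv, map_mk'_eq hle, map_mk'_eq hle, map_mk'_eq hle]

/-- **Periods divide along the tower**: the `σ̄`-period of the image in `Π_I/V` divides the `σ̄`-period in a finer
`Π_I/V'`. [cite: MochizukiAbsTopII2013, Prop 1.3 (viii) p.12] -/
theorem minimalPeriod_map_dvd {V' V : OpenNormalSubgroup (Ext i)} (hle : V' ≤ V) (z τ : Ext i)
    (h : Ext i ⧸ V'.toSubgroup) :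
    Function.minimalPeriod
        ((Equiv.mulRight (QuotientGroup.mk' V.toSubgroup τ)⁻¹).trans (Equiv.mulLeft (QuotientGroup.mk' V.toSubgroup z)))
        (QuotientGroup.map V'.toSubgroup V.toSubgroup (MonoidHom.id _) (le_comap_id_of_le hle) h) ∣
      Function.minimalPeriod
        ((Equiv.mulRight (QuotientGroup.mk' V'.toSubgroup τ)⁻¹).trans (Equiv.mulLeft (QuotientGroup.mk' V'.toSubgroup z)))
        h :=
  ((Function.isPeriodicPt_minimalPeriod _ h).map (semiconj_map_affine hle z τ)).minimalPeriod_dvd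

/-- **Uniformisation over a fibre (compactness of `g₀V`).**  If every `g` over `ḡ ∈ Π_I/V` admits SOME finite quotient
in which the period of its image is divisible by `d`, then ONE finer level `V' ≤ V` works for all points of `Π_I/V'`
over `ḡ`. [cite: RibesZalesskii2010, Lemma 3.2.1] -/
theorem exists_openNormal_forall_fibre_dvd (V : OpenNormalSubgroup (Ext i)) (z τ : Ext i) (gbar : Ext i ⧸ V.toSubgroup)
    (d : ℕ)
    (h : ∀ g : Ext i, QuotientGroup.mk' V.toSubgroup g = gbar → ∃ V₁ : OpenNormalSubgroup (Ext i), d ∣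
      Function.minimalPeriod ((Equiv.mulRight (QuotientGroup.mk' V₁.toSubgroup τ)⁻¹).trans
        (Equiv.mulLeft (QuotientGroup.mk' V₁.toSubgroup z))) (QuotientGroup.mk' V₁.toSubgroup g)) :
    ∃ (V' : OpenNormalSubgroup (Ext i)) (hle : V' ≤ V), ∀ h' : Ext i ⧸ V'.toSubgroup,
      QuotientGroup.map V'.toSubgroup V.toSubgroup (MonoidHom.id _) (le_comap_id_of_le hle) h' = gbar →
        d ∣ Function.minimalPeriod ((Equiv.mulRight (QuotientGroup.mk' V'.toSubgroup τ)⁻¹).trans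
          (Equiv.mulLeft (QuotientGroup.mk' V'.toSubgroup z))) h' := by
  classical
  -- the fibre, a compact set
  set K : Set (Ext i) := {g | QuotientGroup.mk' V.toSubgroup g = gbar} with hK
  have hKc : IsCompact K := by
    refine IsClosed.isCompact ?_
    exact (isClosed_discrete {gbar}).preimage
      (show Continuous fun g : Ext i => (QuotientGroup.mk' V.toSubgroup g : Ext i ⧸ V.toSubgroup) from
        QuotientGroup.continuous_mk)
  -- for each point of the fibre, a level, and the open coset on which that level works
  have h' : ∀ g : K, ∃ V₁ : OpenNormalSubgroup (Ext i), d ∣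
      Function.minimalPeriod ((Equiv.mulRight (QuotientGroup.mk' V₁.toSubgroup τ)⁻¹).trans
        (Equiv.mulLeft (QuotientGroup.mk' V₁.toSubgroup z))) (QuotientGroup.mk' V₁.toSubgroup (g : Ext i)) :=
    fun g => h g g.2
  choose W hW using h'
  let U : K → Set (Ext i) := fun g => (fun v => (g : Ext i) * v) '' (W g : Set (Ext i))
  have hUo : ∀ g, IsOpen (U g) := fun g => (Homeomorph.mulLeft (g : Ext i)).isOpenMap _ (W g).isOpen'
  have hKU : K ⊆ ⋃ g : K, U g := fun g hg =>
    Set.mem_iUnion.mpr ⟨⟨g, hg⟩, ⟨1, (W ⟨g, hg⟩).toSubgroup.one_mem, mul_one g⟩⟩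
  obtain ⟨t, hKt⟩ := hKc.elim_finite_subcover U hUo hKU
  -- the fibre is non-empty, so `t` is
  obtain ⟨g₀, hg₀⟩ := QuotientGroup.mk'_surjective V.toSubgroup gbar
  obtain ⟨j₀, hj₀t, -⟩ := Set.mem_iUnion₂.mp (hKt (show g₀ ∈ K from hg₀))
  have hne : t.Nonempty := ⟨j₀, hj₀t⟩
  refine ⟨V ⊓ t.inf' hne W, inf_le_left, fun h₁ hh₁ => ?_⟩
  obtain ⟨g, rfl⟩ := QuotientGroup.mk'_surjective _ h₁
  have hgK : g ∈ K := by
    change QuotientGroup.mk' V.toSubgroup g = gbar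
    rw [← hh₁, map_mk'_eq inf_le_left]
  obtain ⟨j, hjt, hgj⟩ := Set.mem_iUnion₂.mp (hKt hgK)
  obtain ⟨v, hv, hgv⟩ := hgj
  -- at level `W j`, `g` and `j` have the same image, whose period is divisible by `d`
  have hjg : (QuotientGroup.mk' (W j).toSubgroup (j : Ext i) : Ext i ⧸ (W j).toSubgroup) =
      QuotientGroup.mk' (W j).toSubgroup g := by
    rw [QuotientGroup.mk'_apply, QuotientGroup.mk'_apply, QuotientGroup.eq, ← hgv, inv_mul_cancel_left]
    exact hv
  have hle' : V ⊓ t.inf' hne W ≤ W j := le_trans inf_le_right (Finset.inf'_le _ hjt)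
  refine dvd_trans (hjg ▸ hW j) ?_
  have := minimalPeriod_map_dvd hle' z τ (QuotientGroup.mk' _ g)
  rwa [map_mk'_eq hle'] at this

end Tower

end Literature.AnabelianGeometry.AbsoluteAnabelian.AbsTopII.DehnTwist
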